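import Literature.Analysis.FluidPDE.AlexakisDoeringInterpolation
import Literature.Analysis.FluidPDE.LongTimeAverageNonneg
import HarnessLib

/-!
# Windows, primitives and square-root absorption (toolkit for the age-decoupling inequality)

Analysis/FluidPDE proof-support file (everything proved): the real-variable toolkit behind the
age-decoupling inequality of `FluidPDE/AgeDecouplingInequality`.

* Absorption of a square root: `x ≤ a + 2√(S x d) + S d ⟹ x ≤ (√(S d) + √(a + 2 S d))²`
  (`le_sq_of_le_add_two_mul_sqrt`), its `limsup` forms along a filter
  (`limsup_le_sq_of_eventually_le`, `limsup_le_of_eventually_le_sq`) and the sequence endgame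
  "`limsup ≤ E/(2S)` for every `S > 0` forces the limit `0`" (`tendsto_zero_of_forall_limsup_le_div`,
  `tendsto_zero_of_forall_window`).
* Windows of functions integrable on every `(0, T]` (the integrability class of slices of weak
  solutions): `∫_{t-S}^t f = F(t) - F(t-S)` with the primitive `F(t) = ∫₀ᵗ f`, continuity and
  interval integrability of primitives and windows, the Fubini-free identity
  `∫_S^T ∫_{t-S}^t f = ∫_{T-S}^T F - ∫₀^S F` (translation invariance of Lebesgue measure), whence
  `∫_S^T ∫_{t-S}^t f ≤ S∫₀ᵀ f` for `f ≥ 0` and the signed lower bound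
  `S∫₀ᵀ f - S∫_{T-S}^T |f| - ∫₀^S F ≤ ∫_S^T ∫_{t-S}^t f`, and Cauchy–Schwarz for a window
  `(∫_{t-S}^t w)² ≤ S∫_{t-S}^t w²`.

Everything is stated for Mathlib's interval integral `∫ x in a..b` and real `limsup` (junk `0` for
unbounded families, hence the explicit eventual bounds). No single printed source: standard real
analysis. [folklore]
-/

noncomputable section

open _root_.MeasureTheory _root_.Set _root_.Filter
open scoped _root_.Topology

namespace Literature.Analysis.FluidPDE

namespace AgeDecoupling

/-! ## Elementary absorption of a square root -/

/-- If `x ≤ a + 2√(S·x·d) + S·d` with `x, d, S ≥ 0`, then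
`x ≤ (√(S d) + √(a + 2 S d))²` (complete the square in `√x`). [folklore] -/
theorem le_sq_of_le_add_two_mul_sqrt {x a d S : ℝ} (hx : 0 ≤ x) (hd : 0 ≤ d)
    (hS : 0 ≤ S) (h : x ≤ a + 2 * Real.sqrt (S * x * d) + S * d) :
    x ≤ (Real.sqrt (S * d) + Real.sqrt (a + 2 * S * d)) ^ 2 := by
  set y := Real.sqrt x with hy
  set m := Real.sqrt (S * d) with hm
  have hy0 : 0 ≤ y := Real.sqrt_nonneg _
  have hm0 : 0 ≤ m := Real.sqrt_nonneg _
  have hxy : x = y ^ 2 := (Real.sq_sqrt hx).symm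
  have hm2 : m ^ 2 = S * d := Real.sq_sqrt (mul_nonneg hS hd)
  have hsq : Real.sqrt (S * x * d) = m * y := by
    rw [show S * x * d = (S * d) * x by ring, Real.sqrt_mul (mul_nonneg hS hd)]
  rw [hsq, hxy] at h
  have h1 : (y - m) ^ 2 ≤ a + 2 * S * d := by nlinarith
  have h2 : y - m ≤ Real.sqrt (a + 2 * S * d) := by
    calc y - m ≤ |y - m| := le_abs_self _
      _ = Real.sqrt ((y - m) ^ 2) := (Real.sqrt_sq_eq_abs _).symm
      _ ≤ Real.sqrt (a + 2 * S * d) := Real.sqrt_le_sqrt h1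
  have h3 : y ≤ m + Real.sqrt (a + 2 * S * d) := by linarith
  calc x = y ^ 2 := hxy
    _ ≤ (m + Real.sqrt (a + 2 * S * d)) ^ 2 := pow_le_pow_left₀ hy0 h3 2

/-- `limsup` form of the absorption: along a filter, if eventually
`x ≤ a + 2√(S·x·d) + S·d` with `x, d ≥ 0`, `a ≤ A + ε` and `d ≤ D + ε` eventually for every
`ε > 0` (`S ≥ 0`), then `limsup x ≤ (√(S D) + √(A + 2 S D))²`. [folklore] -/
theorem limsup_le_sq_of_eventually_le {ι : Type*} {l : Filter ι} [l.NeBot] {x a d : ι → ℝ}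
    {A D S : ℝ} (hS : 0 ≤ S)
    (hx0 : ∀ᶠ i in l, 0 ≤ x i) (hd0 : ∀ᶠ i in l, 0 ≤ d i)
    (ha : ∀ ε, 0 < ε → ∀ᶠ i in l, a i ≤ A + ε) (hd : ∀ ε, 0 < ε → ∀ᶠ i in l, d i ≤ D + ε)
    (h : ∀ᶠ i in l, x i ≤ a i + 2 * Real.sqrt (S * x i * d i) + S * d i) :
    limsup x l ≤ (Real.sqrt (S * D) + Real.sqrt (A + 2 * S * D)) ^ 2 := by
  set g : ℝ → ℝ := fun δ =>
    (Real.sqrt (S * (D + δ)) + Real.sqrt ((A + δ) + 2 * S * (D + δ))) ^ 2 with hg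
  have hδ : ∀ δ, 0 < δ → limsup x l ≤ g δ := by
    intro δ hδ
    refine limsup_le_of_le (isCoboundedUnder_le_of_eventually_le l hx0) ?_
    filter_upwards [h, hx0, hd0, ha δ hδ, hd δ hδ] with i hi hx0i hd0i hai hdi
    refine (le_sq_of_le_add_two_mul_sqrt hx0i hd0i hS hi).trans ?_
    rw [hg]
    apply pow_le_pow_left₀ (by positivity)
    apply add_le_add
    · exact Real.sqrt_le_sqrt (mul_le_mul_of_nonneg_left hdi hS)
    · apply Real.sqrt_le_sqrt
      have : 2 * S * d i ≤ 2 * S * (D + δ) := mul_le_mul_of_nonneg_left hdi (by positivity)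
      linarith
  have hcont : ContinuousAt g 0 := by
    rw [hg]
    fun_prop
  have hg0 : g 0 = (Real.sqrt (S * D) + Real.sqrt (A + 2 * S * D)) ^ 2 := by
    simp [hg]
  refine le_of_forall_pos_lt_add fun ε hε => ?_
  have hev : ∀ᶠ δ in 𝓝[>] (0 : ℝ), g δ < g 0 + ε :=
    (hcont.tendsto.eventually (gt_mem_nhds (by linarith))).filter_mono nhdsWithin_le_nhds
  obtain ⟨δ, hδlt, hδpos⟩ := (hev.and self_mem_nhdsWithin).exists
  rw [hg0] at hδlt
  exact (hδ δ hδpos).trans_lt hδlt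

/-- If a nonnegative, eventually bounded sequence has `limsup ≤ E/(2S)` for every `S > 0`, it
tends to `0`. [folklore] -/
theorem tendsto_zero_of_forall_limsup_le_div {x : ℕ → ℝ} {E : ℝ} (hx0 : ∀ j, 0 ≤ x j)
    (hbdd : IsBoundedUnder (· ≤ ·) atTop x)
    (h : ∀ S : ℝ, 0 < S → limsup x atTop ≤ E / (2 * S)) : Tendsto x atTop (𝓝 0) := by
  have hE : 0 ≤ E := by
    have h1 := h 1 one_pos
    have h0 : 0 ≤ limsup x atTop :=
      le_limsup_of_frequently_le (Frequently.of_forall fun j => hx0 j) hbdd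
    linarith
  have hlim : limsup x atTop ≤ 0 := by
    refine le_of_forall_pos_lt_add fun ε hε => ?_
    have hS : 0 < E / ε + 1 := by positivity
    refine (h _ hS).trans_lt ?_
    rw [zero_add, div_lt_iff₀ (by positivity)]
    have : E < ε * (E / ε + 1) := by
      rw [mul_add, mul_div_cancel₀ _ hε.ne', mul_one]; linarith
    nlinarith
  have hbdd' : IsBoundedUnder (· ≥ ·) atTop x := isBoundedUnder_of ⟨0, fun j => hx0 j⟩
  refine tendsto_of_le_liminf_of_limsup_le ?_ hlim hbdd hbdd'
  exact le_liminf_of_le hbdd.isCoboundedUnder_ge (Eventually.of_forall hx0)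

/-- From the absorbed form to a clean `limsup`: if eventually
`x ≤ (√(S d) + √(a + 2 S d))²` with `x ≥ 0`, `a ≤ A + ε` and `d ≤ ε` eventually for every
`ε > 0` (`A, S ≥ 0`), then `limsup x ≤ A`. [folklore] -/
theorem limsup_le_of_eventually_le_sq {ι : Type*} {l : Filter ι} [l.NeBot] {x a d : ι → ℝ}
    {A S : ℝ} (hS : 0 ≤ S) (hA : 0 ≤ A) (hx0 : ∀ᶠ i in l, 0 ≤ x i)
    (ha : ∀ ε, 0 < ε → ∀ᶠ i in l, a i ≤ A + ε) (hd : ∀ ε, 0 < ε → ∀ᶠ i in l, d i ≤ ε)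
    (h : ∀ᶠ i in l, x i ≤ (Real.sqrt (S * d i) + Real.sqrt (a i + 2 * S * d i)) ^ 2) :
    limsup x l ≤ A := by
  set g : ℝ → ℝ := fun δ => (Real.sqrt (S * δ) + Real.sqrt ((A + δ) + 2 * S * δ)) ^ 2 with hg
  have hδ : ∀ δ, 0 < δ → limsup x l ≤ g δ := by
    intro δ hδ
    refine limsup_le_of_le (isCoboundedUnder_le_of_eventually_le l hx0) ?_
    filter_upwards [h, ha δ hδ, hd δ hδ] with i hi hai hdi
    refine hi.trans ?_
    rw [hg]
    apply pow_le_pow_left₀ (by positivity)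
    apply add_le_add
    · exact Real.sqrt_le_sqrt (mul_le_mul_of_nonneg_left hdi hS)
    · apply Real.sqrt_le_sqrt
      have : 2 * S * d i ≤ 2 * S * δ := mul_le_mul_of_nonneg_left hdi (by positivity)
      linarith
  have hcont : ContinuousAt g 0 := by
    rw [hg]
    fun_prop
  have hg0 : g 0 = A := by
    simp only [hg, mul_zero, Real.sqrt_zero, add_zero, zero_add]
    exact Real.sq_sqrt hA
  refine le_of_forall_pos_lt_add fun ε hε => ?_
  have hev : ∀ᶠ δ in 𝓝[>] (0 : ℝ), g δ < g 0 + ε :=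
    (hcont.tendsto.eventually (gt_mem_nhds (by linarith))).filter_mono nhdsWithin_le_nhds
  obtain ⟨δ, hδlt, hδpos⟩ := (hev.and self_mem_nhdsWithin).exists
  rw [hg0] at hδlt
  exact (hδ δ hδpos).trans_lt hδlt

/-- **Sequence form of age decoupling.** A nonnegative sequence `x` such that for every window
`S > 0` there are `a, d` with `d → 0`, eventually `a ≤ E/(2S)` and eventually
`x ≤ (√(S d) + √(a + 2 S d))²`, tends to `0` (`E ≥ 0`). [folklore] -/
theorem tendsto_zero_of_forall_window {x : ℕ → ℝ} {E : ℝ} (hE : 0 ≤ E) (hx0 : ∀ j, 0 ≤ x j)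
    (h : ∀ S : ℝ, 0 < S → ∃ a d : ℕ → ℝ, Tendsto d atTop (𝓝 0) ∧
      (∀ᶠ j in atTop, a j ≤ E / (2 * S)) ∧
      ∀ᶠ j in atTop, x j ≤ (Real.sqrt (S * d j) + Real.sqrt (a j + 2 * S * d j)) ^ 2) :
    Tendsto x atTop (𝓝 0) := by
  have hlim : ∀ S : ℝ, 0 < S → limsup x atTop ≤ E / (2 * S) := by
    intro S hS
    obtain ⟨a, d, hd, ha, hx⟩ := h S hS
    refine limsup_le_of_eventually_le_sq hS.le (by positivity) (Eventually.of_forall hx0)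
      (fun ε hε => ha.mono fun j hj => by linarith) (fun ε hε => ?_) hx
    exact (hd.eventually (ge_mem_nhds hε)).mono fun j hj => hj
  -- eventual boundedness from the window `S = 1`
  obtain ⟨a, d, hd, ha, hx⟩ := h 1 one_pos
  have hbdd : IsBoundedUnder (· ≤ ·) atTop x := by
    refine ⟨(Real.sqrt (1 * 1) + Real.sqrt (E / (2 * 1) + 2 * 1 * 1)) ^ 2, ?_⟩
    rw [eventually_map]
    filter_upwards [hx, ha, hd.eventually (ge_mem_nhds one_pos)] with j hxj haj hdj
    refine hxj.trans (pow_le_pow_left₀ (by positivity) (add_le_add ?_ ?_) 2)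
    · exact Real.sqrt_le_sqrt (by linarith)
    · exact Real.sqrt_le_sqrt (by linarith)
  exact tendsto_zero_of_forall_limsup_le_div hx0 hbdd hlim

/-! ## Windows and primitives of functions integrable on every `(0, T]` -/

section Windows

variable {f : ℝ → ℝ}

/-- A function integrable on every `(0,T]` is interval integrable between nonnegative
endpoints. [folklore] -/
theorem intervalIntegrable_of_forall_integrableOn (hf : ∀ T, IntegrableOn f (Ioc 0 T)) {a b : ℝ}
    (ha : 0 ≤ a) (hb : 0 ≤ b) : IntervalIntegrable f volume a b := by
  rw [intervalIntegrable_iff, uIoc]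
  exact (hf _).mono_set (Ioc_subset_Ioc_left (le_min ha hb))

/-- The primitive `t ↦ ∫₀ᵗ f` of a function integrable on every `(0,T]` is continuous on
`[0, T]`. [folklore] -/
theorem continuousOn_primitive (hf : ∀ T, IntegrableOn f (Ioc 0 T)) (T : ℝ) :
    ContinuousOn (fun t => ∫ s in (0 : ℝ)..t, f s) (Icc 0 T) := by
  rcases le_or_gt 0 T with hT | hT
  · have h := intervalIntegral.continuousOn_primitive_interval (μ := volume) (f := f) (a := 0)
      (b := T) ?_
    · rwa [uIcc_of_le hT] at h
    · rw [uIcc_of_le hT, integrableOn_Icc_iff_integrableOn_Ioc]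
      exact hf T
  · rw [Icc_eq_empty (not_le.mpr hT)]
    exact continuousOn_empty _

/-- The primitive `t ↦ ∫₀ᵗ f` is interval integrable between nonnegative endpoints. [folklore] -/
theorem intervalIntegrable_primitive (hf : ∀ T, IntegrableOn f (Ioc 0 T)) {a b : ℝ}
    (ha : 0 ≤ a) (hb : 0 ≤ b) :
    IntervalIntegrable (fun t => ∫ s in (0 : ℝ)..t, f s) volume a b := by
  refine ContinuousOn.intervalIntegrable ((continuousOn_primitive hf (max a b)).mono ?_)
  rw [uIcc]
  exact Icc_subset_Icc_left (le_min ha hb)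

/-- A window integral is a difference of primitives: `∫_{t-S}^t f = ∫₀ᵗ f - ∫₀^{t-S} f`
(`0 ≤ S ≤ t`). [folklore] -/
theorem window_eq_sub (hf : ∀ T, IntegrableOn f (Ioc 0 T)) {S t : ℝ} (hS : 0 ≤ S) (ht : S ≤ t) :
    ∫ s in (t - S)..t, f s = (∫ s in (0 : ℝ)..t, f s) - ∫ s in (0 : ℝ)..(t - S), f s :=
  (intervalIntegral.integral_interval_sub_left
    (intervalIntegrable_of_forall_integrableOn hf le_rfl (hS.trans ht))
    (intervalIntegrable_of_forall_integrableOn hf le_rfl (by linarith))).symm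

/-- The window integral `t ↦ ∫_{t-S}^t f` is continuous on `[S, T]`. [folklore] -/
theorem continuousOn_window (hf : ∀ T, IntegrableOn f (Ioc 0 T)) {S : ℝ} (hS : 0 ≤ S) (T : ℝ) :
    ContinuousOn (fun t => ∫ s in (t - S)..t, f s) (Icc S T) := by
  have h1 : ContinuousOn (fun t => (∫ s in (0 : ℝ)..t, f s) - ∫ s in (0 : ℝ)..(t - S), f s)
      (Icc S T) := by
    refine ((continuousOn_primitive hf T).mono (Icc_subset_Icc_left hS)).sub ?_
    refine (continuousOn_primitive hf T).comp (continuousOn_id.sub continuousOn_const) ?_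
    intro t ht
    exact ⟨by linarith [ht.1], by linarith [ht.2]⟩
  exact h1.congr fun t ht => window_eq_sub hf hS ht.1

/-- The window integral is interval integrable on `[S, T]`. [folklore] -/
theorem intervalIntegrable_window (hf : ∀ T, IntegrableOn f (Ioc 0 T)) {S T : ℝ} (hS : 0 ≤ S)
    (hT : S ≤ T) : IntervalIntegrable (fun t => ∫ s in (t - S)..t, f s) volume S T :=
  ContinuousOn.intervalIntegrable (by rw [uIcc_of_le hT]; exact continuousOn_window hf hS T)

/-- **Integrated windows via primitives**: `∫_S^T ∫_{t-S}^t f = ∫_{T-S}^T F - ∫₀^S F`,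
`F(t) = ∫₀ᵗ f` (`0 ≤ S ≤ T`; translation invariance of Lebesgue measure, no Fubini). [folklore] -/
theorem integral_window_eq (hf : ∀ T, IntegrableOn f (Ioc 0 T)) {S T : ℝ} (hS : 0 ≤ S)
    (hT : S ≤ T) :
    ∫ t in S..T, (∫ s in (t - S)..t, f s) =
      (∫ t in (T - S)..T, ∫ s in (0 : ℝ)..t, f s) - ∫ t in (0 : ℝ)..S, ∫ s in (0 : ℝ)..t, f s := by
  set F : ℝ → ℝ := fun t => ∫ s in (0 : ℝ)..t, f s with hF
  have hFi : ∀ a b, 0 ≤ a → 0 ≤ b → IntervalIntegrable F volume a b := fun a b ha hb =>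
    intervalIntegrable_primitive hf ha hb
  have h1 : ∫ t in S..T, (∫ s in (t - S)..t, f s) = ∫ t in S..T, (F t - F (t - S)) := by
    refine intervalIntegral.integral_congr fun t ht => ?_
    rw [uIcc_of_le hT] at ht
    exact window_eq_sub hf hS ht.1
  have h2 : IntervalIntegrable (fun t => F (t - S)) volume S T := by
    have := (hFi 0 (T - S) le_rfl (by linarith)).comp_sub_right S
    simpa using this
  rw [h1, intervalIntegral.integral_sub (hFi S T hS (hS.trans hT)) h2,
    intervalIntegral.integral_comp_sub_right F S, sub_self]
  have e1 : (∫ t in (0 : ℝ)..T, F t) - ∫ t in (0 : ℝ)..S, F t = ∫ t in S..T, F t :=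
    intervalIntegral.integral_interval_sub_left (hFi 0 T le_rfl (hS.trans hT)) (hFi 0 S le_rfl hS)
  have e2 : (∫ t in (0 : ℝ)..T, F t) - ∫ t in (0 : ℝ)..(T - S), F t = ∫ t in (T - S)..T, F t :=
    intervalIntegral.integral_interval_sub_left (hFi 0 T le_rfl (hS.trans hT))
      (hFi 0 (T - S) le_rfl (by linarith))
  linarith

/-- **Averaged windows of a nonnegative function**: `∫_S^T ∫_{t-S}^t f ≤ S ∫₀ᵀ f` for `f ≥ 0`,
`0 ≤ S ≤ T`. [folklore] -/
theorem integral_window_le (hf : ∀ T, IntegrableOn f (Ioc 0 T)) (hf0 : ∀ t, 0 ≤ f t) {S T : ℝ}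
    (hS : 0 ≤ S) (hT : S ≤ T) :
    ∫ t in S..T, (∫ s in (t - S)..t, f s) ≤ S * ∫ s in (0 : ℝ)..T, f s := by
  rw [integral_window_eq hf hS hT]
  set F : ℝ → ℝ := fun t => ∫ s in (0 : ℝ)..t, f s with hF
  have hFmono : ∀ a b, 0 ≤ a → a ≤ b → F a ≤ F b := fun a b ha hab =>
    intervalIntegral.integral_mono_interval le_rfl ha hab (ae_of_all _ fun t => hf0 t)
      (intervalIntegrable_of_forall_integrableOn hf le_rfl (ha.trans hab))
  have hF0 : ∀ a, 0 ≤ a → 0 ≤ F a := fun a ha =>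
    intervalIntegral.integral_nonneg ha fun t _ => hf0 t
  have h1 : ∫ t in (T - S)..T, F t ≤ ∫ _ in (T - S)..T, F T :=
    intervalIntegral.integral_mono_on (by linarith)
      (intervalIntegrable_primitive hf (by linarith) (hS.trans hT)) intervalIntegrable_const
      fun t ht => hFmono t T (by linarith [ht.1]) ht.2
  have h2 : ∫ _ in (T - S)..T, F T = S * F T := by
    rw [intervalIntegral.integral_const, smul_eq_mul]; ring
  have h3 : 0 ≤ ∫ t in (0 : ℝ)..S, F t := intervalIntegral.integral_nonneg hS fun t ht => hF0 t ht.1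
  linarith

/-- **Averaged windows of a signed function**: `S ∫₀ᵀ f - S ∫_{T-S}^T |f| - ∫₀^S F ≤ ∫_S^T ∫_{t-S}^t f`
with `F(t) = ∫₀ᵗ f`, `0 ≤ S ≤ T`. [folklore] -/
theorem sub_le_integral_window (hf : ∀ T, IntegrableOn f (Ioc 0 T)) {S T : ℝ} (hS : 0 ≤ S)
    (hT : S ≤ T) :
    S * (∫ s in (0 : ℝ)..T, f s) - S * (∫ s in (T - S)..T, |f s|) -
        ∫ t in (0 : ℝ)..S, ∫ s in (0 : ℝ)..t, f s ≤
      ∫ t in S..T, (∫ s in (t - S)..t, f s) := by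
  rw [integral_window_eq hf hS hT]
  set F : ℝ → ℝ := fun t => ∫ s in (0 : ℝ)..t, f s with hF
  have hii : ∀ a b, 0 ≤ a → 0 ≤ b → IntervalIntegrable f volume a b := fun a b ha hb =>
    intervalIntegrable_of_forall_integrableOn hf ha hb
  have key : ∀ t ∈ Icc (T - S) T, F T - (∫ s in (T - S)..T, |f s|) ≤ F t := by
    intro t ht
    have ht0 : 0 ≤ t := by linarith [ht.1]
    have e : F T - F t = ∫ s in t..T, f s :=
      intervalIntegral.integral_interval_sub_left (hii 0 T le_rfl (hS.trans hT)) (hii 0 t le_rfl ht0)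
    have b1 : ∫ s in t..T, f s ≤ ∫ s in t..T, |f s| :=
      intervalIntegral.integral_mono_on ht.2 (hii t T ht0 (hS.trans hT))
        (hii t T ht0 (hS.trans hT)).abs fun s _ => le_abs_self _
    have b2 : ∫ s in t..T, |f s| ≤ ∫ s in (T - S)..T, |f s| :=
      intervalIntegral.integral_mono_interval ht.1 ht.2 le_rfl (ae_of_all _ fun _ => abs_nonneg _)
        (hii (T - S) T (by linarith) (hS.trans hT)).abs
    linarith
  have h1 : ∫ _ in (T - S)..T, (F T - ∫ s in (T - S)..T, |f s|) ≤ ∫ t in (T - S)..T, F t :=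
    intervalIntegral.integral_mono_on (by linarith) intervalIntegrable_const
      (intervalIntegrable_primitive hf (by linarith) (hS.trans hT)) key
  rw [intervalIntegral.integral_const, smul_eq_mul] at h1
  have h2 : (T - (T - S)) * (F T - ∫ s in (T - S)..T, |f s|) =
      S * F T - S * ∫ s in (T - S)..T, |f s| := by ring
  linarith

/-- **Cauchy–Schwarz for a window**: `(∫_{t-S}^t w)² ≤ S ∫_{t-S}^t w²` for `w ≥ 0`
(`0 ≤ S ≤ t`). [folklore] -/
theorem sq_window_le {w : ℝ → ℝ} (hw : ∀ T, IntegrableOn w (Ioc 0 T))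
    (hw2 : ∀ T, IntegrableOn (fun s => w s ^ 2) (Ioc 0 T)) (hw0 : ∀ t, 0 ≤ w t) {S t : ℝ}
    (hS : 0 ≤ S) (ht : S ≤ t) :
    (∫ s in (t - S)..t, w s) ^ 2 ≤ S * ∫ s in (t - S)..t, w s ^ 2 := by
  have hle : t - S ≤ t := by linarith
  rw [intervalIntegral.integral_of_le hle, intervalIntegral.integral_of_le hle]
  set μ : Measure ℝ := volume.restrict (Ioc (t - S) t) with hμ
  have hwi : Integrable w μ := (hw t).mono_set (Ioc_subset_Ioc_left (by linarith))
  have hw2i : Integrable (fun s => w s ^ 2) μ := (hw2 t).mono_set (Ioc_subset_Ioc_left (by linarith))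
  have h1 : ∫ s, w s ∂μ ≤ Real.sqrt ((∫ _, (1 : ℝ) ∂μ) * ∫ s, w s ^ 2 ∂μ) :=
    integral_le_sqrt_integral_mul_integral (ae_of_all _ fun s => hw0 s)
      (ae_of_all _ fun _ => zero_le_one) (ae_of_all _ fun s => sq_nonneg _)
      (ae_of_all _ fun s => by rw [one_mul]) hwi.aestronglyMeasurable (integrable_const _) hw2i
  have h1' : ∫ _, (1 : ℝ) ∂μ = S := by
    rw [hμ, integral_const, smul_eq_mul, mul_one, Measure.real, Measure.restrict_apply_univ,
      Real.volume_Ioc, ENNReal.toReal_ofReal (by linarith)]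
    ring
  rw [h1'] at h1
  have h0 : 0 ≤ ∫ s, w s ∂μ := integral_nonneg fun s => hw0 s
  have hS0 : 0 ≤ S * ∫ s, w s ^ 2 ∂μ := mul_nonneg hS (integral_nonneg fun s => sq_nonneg _)
  calc (∫ s, w s ∂μ) ^ 2 ≤ (Real.sqrt (S * ∫ s, w s ^ 2 ∂μ)) ^ 2 := pow_le_pow_left₀ h0 h1 2
    _ = S * ∫ s, w s ^ 2 ∂μ := Real.sq_sqrt hS0

end Windows

end AgeDecoupling

end Literature.Analysis.FluidPDE

end
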